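import Summits.Ventures.CertifiedManyBodySolver.Rows.HalfFilledTLLiebGram
import Summits.Ventures.CertifiedManyBodySolver.Rows.HalfFilledTLSpinWard
import Summits.Ventures.CertifiedManyBodySolver.Rows.HalfFilledTLWords
import HarnessLib

/-!
# Ventures/CertifiedManyBodySolver — Rows part 32: `HalfFilledTLDeclaredRows` (the CLAIM-NODE SHAPE of a
`setting: TL` correlator certificate that carries DECLARED Lieb-Gram / spin-Ward hypothesis rows)

HONEST FRAMING: first certified bounds; not a superconductivity verdict; every number certified or labelled float.

WHAT THIS FILE IS (m2-3 gen-6 ask, unit INBOX 2026-08-21T20:42Z; engines ruling R-340(b4)). A TL correlator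
certificate of the `mbsolver.m2-3.liebrows/1` kind (HOME/certs/m2/cnn-srp/<case>_su21/) is: a base Han-K
translation-invariant relaxation + the ENERGY row `ω(h₀) ≤ u` + `k` DECLARED `le` rows of kind `liebgram`
(`Σ_{a,b} G_ab ω(u(w_a) d̃_ε(w_b)) ≥ 0`, `G = F Fᴴ` or `c̄ cᵀ`, `ε` the staggered sign) + `m` DECLARED `eq` rows
of kind `su2_ward` (`ω([S^α_Λ, A]) = 0`). A reader verifies the certificate's ARITHMETIC GIVEN the declared
rows. This file is the Lean side of that split:
* `M2.LiebRows ω` / `M2.WardRows ω` — the two declared row FAMILIES as predicates on an infinite-volume state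
  (every region, every `G ⪰ 0` and word family, both Lieb blocks; every region and every `A ∈ 𝔄(Λ)`, all three
  spin components);
* `M2.IsTLGS.liebRows` / `.wardRows` — on TLGS(U) (`U > 0`) both families are THEOREMS (Rows parts 29 / 30:
  `IsTLGS.re_expect_liebForm_nonneg`, `…_liebFormFlip_nonneg`, `IsTLGS.expect_spin{Plus,Minus,Z}_commutator_eq_zero`);
* `M2.DeclRowsCorrLowerRow U u q Λ X` / `…UpperRow` — the NODE SHAPE: the certificate-shaped row of
  Statement.lean §S2 read over TLGS(U) (`squareCorrLowerRow_iff`) with the two families as EXTRA HYPOTHESES,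
  i.e. exactly what "arithmetic given the declared rows" proves;
* the DISCHARGE `DeclRowsCorrLowerRow.squareCorrLowerRow` (and upper; and the `iff`s): a declared-row node IS
  the plain `SquareCorrLowerRow` / `SquareCorrUpperRow` node, so every existing join applies verbatim
  (`SpinNNLowerRow.of_literal`, `SpinNNUpperRow.of_literalNeg`, `CorrelatorRow.of_lower_upper`, parts 11/12/15),
  and the specialisations `SpinNNLowerRow.of_declRows`, `SpinNNUpperRow.of_declRowsNeg`, `M2DoccLowerRow.of_declRows`,
  `M2DoccUpperRow.of_declRows`, `CorrelatorRow.of_declRows`.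
NODE RECIPE (typer / lit-4; the node itself is filed only on a referee-signed CERTIFIED row, as always): for
m2-3's `K4U8_agg_su21` (objective `ω(−V)`, `V` = bond-averaged `𝐒_0·𝐒_{e_i}`, claimed `C_nn ≤ −b`,
`b = 3241031322833661033353909241/47223664828696452136960000000`, energy row `u` = #22):
  `@[conjecture] def cert_rN_…_su21_Sup : Prop := M2.DeclRowsCorrLowerRow 8 (-34106764425/68719476736) b nnSupport M2.spinDotNNAvg2Neg`
  `theorem … (h : cert_rN_…) : M2.SpinNNUpperRow 8 (-34106764425/68719476736) (-b) := M2.SpinNNUpperRow.of_declRowsNeg (by norm_num) h`.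
READING RULE (TL-STATEMENT §9.25): the node is an implication over claim data exactly like #138–#141; what the
referee signs is the arithmetic given the declared rows (reader) — the declared rows are not trusted input but
theorems discharged HERE by name; translation / point-group reduction of the base relaxation stays on the
reader's side as for every reduce-mode certificate (`IsTorusLimitOf.re_expect_ge_of_window_certificate_d4_ineq`
pattern). No row is filed here; theorems only, no `sorry`, certificate-free.
[cite: LiebPRL1989, Theorem 2] [cite: WangEtAl2024, §III] [cite: BratteliRobinsonII1997, §6.2.4]
-/

noncomputable section

namespace Summit.Ventures.CertifiedManyBodySolver

open Literature.MathematicalPhysics.QuantumLattice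
open Literature.MathematicalPhysics.QuantumLattice.LiebTwo
open Matrix HubbardWave0 Literature.Probability.LatticeModels ThermodynamicLimit Filter Topology
open Summit.HubbardSuperconductivity.ManyBodyBootstrap.Bounds (nnSupport)
open scoped ComplexOrder BigOperators

namespace M2

/-! ## §1 The declared row families -/

/-- **The Lieb-Gram row family** of an infinite-volume state `ω` of `ℤ²`: for every finite region `Λ`, every
`n`, every `G ⪰ 0` and every family of `n` hopping words on `Λ`, BOTH Lieb blocks are nonnegative:
`0 ≤ Re ω_Λ(liebForm ε G w)` and `0 ≤ Re ω_Λ(liebFormFlip ε G w)`, `ε = regionSign Λ` the staggered sign.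
(The `liebgram` / `liebgram_flip` declared `le` rows of a TL certificate are instances.) [cite: LiebPRL1989, proof of Theorem 2] -/
def LiebRows (ω : InfVolFermionState 2) : Prop :=
  ∀ (Λ : Finset (Site 2)) (n : ℕ) (G : Matrix (Fin n) (Fin n) ℂ), G.PosSemidef →
    ∀ w : Fin n → List (PolySite Λ × PolySite Λ),
      0 ≤ (ω.expect Λ (liebForm (regionSign Λ) G w)).re ∧
        0 ≤ (ω.expect Λ (liebFormFlip (regionSign Λ) G w)).re

/-- **The spin-SU(2) Ward row family** of `ω`: for every finite region `Λ` and every `A ∈ 𝔄(Λ)` the three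
commutators with the region's total spin have zero expectation (the `su2_ward` declared `eq` rows of a TL
certificate are instances, `A` = words of definite spin charge). [cite: LiebPRL1989, Theorem 2] -/
def WardRows (ω : InfVolFermionState 2) : Prop :=
  ∀ (Λ : Finset (Site 2)) (A : FermionOp Λ),
    ω.expect Λ (spinPlus * A - A * spinPlus) = 0 ∧ ω.expect Λ (spinMinus * A - A * spinMinus) = 0 ∧
      ω.expect Λ (HubbardWave0.spinZ * A - A * HubbardWave0.spinZ) = 0

/-- **On TLGS(U) the Lieb-Gram family holds** (Rows part 29 by name). [cite: LiebPRL1989, proof of Theorem 2] [cite: KullEtAl2024, §5.3] -/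
theorem IsTLGS.liebRows {U : ℝ} (hU : 0 < U) {ω : InfVolFermionState 2} (h : IsTLGS U ω) : LiebRows ω :=
  fun Λ _ _ hG w => ⟨h.re_expect_liebForm_nonneg hU Λ hG w, h.re_expect_liebFormFlip_nonneg hU Λ hG w⟩

/-- **On TLGS(U) the Ward family holds** (Rows part 30 by name). [cite: LiebPRL1989, Theorem 2] -/
theorem IsTLGS.wardRows {U : ℝ} (hU : 0 < U) {ω : InfVolFermionState 2} (h : IsTLGS U ω) : WardRows ω :=
  fun Λ A => ⟨h.expect_spinPlus_commutator_eq_zero hU Λ A, h.expect_spinMinus_commutator_eq_zero hU Λ A,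
    h.expect_spinZ_commutator_eq_zero hU Λ A⟩

/-- The RANK-ONE line a certificate declares (`kind rank1`, integer vector `c`): `G = c̄ cᵀ`.
[cite: LiebPRL1989, proof of Theorem 2] -/
theorem LiebRows.vecMulVec {ω : InfVolFermionState 2} (h : LiebRows ω) (Λ : Finset (Site 2)) {n : ℕ}
    (c : Fin n → ℂ) (w : Fin n → List (PolySite Λ × PolySite Λ)) :
    0 ≤ (ω.expect Λ (liebForm (regionSign Λ) (vecMulVec (star c) c) w)).re :=
  (h Λ n _ (Matrix.posSemidef_vecMulVec_star_self c) w).1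

/-- The AGGREGATED line a certificate declares (`kind agg`, integer factor `F`): `G = F Fᴴ ⪰ 0`.
[cite: LiebPRL1989, proof of Theorem 2] -/
theorem LiebRows.factor {ω : InfVolFermionState 2} (h : LiebRows ω) (Λ : Finset (Site 2)) {n m : ℕ}
    (F : Matrix (Fin n) (Fin m) ℂ) (w : Fin n → List (PolySite Λ × PolySite Λ)) :
    0 ≤ (ω.expect Λ (liebForm (regionSign Λ) (F * Fᴴ) w)).re :=
  (h Λ n _ (Matrix.posSemidef_self_mul_conjTranspose F) w).1

/-- Flipped aggregated line (`liebgram_flip`, `G = F Fᴴ`). [cite: LiebPRL1989, proof of Theorem 2] -/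
theorem LiebRows.factor_flip {ω : InfVolFermionState 2} (h : LiebRows ω) (Λ : Finset (Site 2)) {n m : ℕ}
    (F : Matrix (Fin n) (Fin m) ℂ) (w : Fin n → List (PolySite Λ × PolySite Λ)) :
    0 ≤ (ω.expect Λ (liebFormFlip (regionSign Λ) (F * Fᴴ) w)).re :=
  (h Λ n _ (Matrix.posSemidef_self_mul_conjTranspose F) w).2

/-- The symmetric form of a declared Ward `eq` row: `ω_Λ(S⁺_Λ A) = ω_Λ(A S⁺_Λ)`. [cite: LiebPRL1989, Theorem 2] -/
theorem WardRows.expect_spinPlus_mul_eq {ω : InfVolFermionState 2} (h : WardRows ω) (Λ : Finset (Site 2))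
    (A : FermionOp Λ) : ω.expect Λ (spinPlus * A) = ω.expect Λ (A * spinPlus) := by
  have h0 := (h Λ A).1
  rwa [map_sub, sub_eq_zero] at h0

/-! ## §2 The node shape: certificate rows WITH declared hypothesis rows -/

/-- **Declared-row correlator LOWER node**: for every `ω ∈ TLGS(U)` satisfying the Lieb-Gram and Ward row
families and GIVEN the energy row `e₀(U) ≤ u`, `q ≤ Re ω_Λ(X)` — the statement a reader certifies as
"arithmetic given the declared rows". [cite: WangEtAl2024, §III] [cite: LiebPRL1989, Theorem 2] -/
def DeclRowsCorrLowerRow (U : ℝ) (u q : ℚ) (Λ : Finset (Site 2)) (X : FermionOp Λ) : Prop :=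
  ∀ ω : InfVolFermionState 2, IsTLGS U ω → LiebRows ω → WardRows ω →
    energyDensity2D 1 U 1 ≤ ((u : ℚ) : ℝ) → ((q : ℚ) : ℝ) ≤ (ω.expect Λ X).re

/-- **Declared-row correlator UPPER node**: `Re ω_Λ(X) ≤ q` under the same hypotheses. [cite: WangEtAl2024, §III] [cite: LiebPRL1989, Theorem 2] -/
def DeclRowsCorrUpperRow (U : ℝ) (u q : ℚ) (Λ : Finset (Site 2)) (X : FermionOp Λ) : Prop :=
  ∀ ω : InfVolFermionState 2, IsTLGS U ω → LiebRows ω → WardRows ω →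
    energyDensity2D 1 U 1 ≤ ((u : ℚ) : ℝ) → (ω.expect Λ X).re ≤ ((q : ℚ) : ℝ)

/-- **DISCHARGE (lower)**: on TLGS(U), `U > 0`, the declared rows are theorems, so a declared-row node IS the
plain certificate-shaped row `SquareCorrLowerRow` of Statement.lean §S2. [cite: WangEtAl2024, §III] [cite: LiebPRL1989, Theorem 2] -/
theorem DeclRowsCorrLowerRow.squareCorrLowerRow {U : ℝ} (hU : 0 < U) {u q : ℚ} {Λ : Finset (Site 2)}
    {X : FermionOp Λ} (h : DeclRowsCorrLowerRow U u q Λ X) : SquareCorrLowerRow U u q Λ X :=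
  squareCorrLowerRow_iff.2 fun ω hω hE => h ω hω (hω.liebRows hU) (hω.wardRows hU) hE

/-- **DISCHARGE (upper)**. [cite: WangEtAl2024, §III] [cite: LiebPRL1989, Theorem 2] -/
theorem DeclRowsCorrUpperRow.squareCorrUpperRow {U : ℝ} (hU : 0 < U) {u q : ℚ} {Λ : Finset (Site 2)}
    {X : FermionOp Λ} (h : DeclRowsCorrUpperRow U u q Λ X) : SquareCorrUpperRow U u q Λ X :=
  squareCorrUpperRow_iff.2 fun ω hω hE => h ω hω (hω.liebRows hU) (hω.wardRows hU) hE

/-- Conversely a plain row is a declared-row node (drop the hypotheses). [cite: WangEtAl2024, §III] -/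
theorem DeclRowsCorrLowerRow.of_squareCorrLowerRow {U : ℝ} {u q : ℚ} {Λ : Finset (Site 2)} {X : FermionOp Λ}
    (h : SquareCorrLowerRow U u q Λ X) : DeclRowsCorrLowerRow U u q Λ X :=
  fun ω hω _ _ hE => squareCorrLowerRow_iff.1 h ω hω hE

/-- Upper twin of `DeclRowsCorrLowerRow.of_squareCorrLowerRow`. [cite: WangEtAl2024, §III] -/
theorem DeclRowsCorrUpperRow.of_squareCorrUpperRow {U : ℝ} {u q : ℚ} {Λ : Finset (Site 2)} {X : FermionOp Λ}
    (h : SquareCorrUpperRow U u q Λ X) : DeclRowsCorrUpperRow U u q Λ X :=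
  fun ω hω _ _ hE => squareCorrUpperRow_iff.1 h ω hω hE

/-- **The two node shapes are EQUIVALENT** (`U > 0`): declaring the Lieb / Ward rows changes what the reader
must check, not what is claimed. [cite: WangEtAl2024, §III] [cite: LiebPRL1989, Theorem 2] -/
theorem declRowsCorrLowerRow_iff {U : ℝ} (hU : 0 < U) {u q : ℚ} {Λ : Finset (Site 2)} {X : FermionOp Λ} :
    DeclRowsCorrLowerRow U u q Λ X ↔ SquareCorrLowerRow U u q Λ X :=
  ⟨fun h => h.squareCorrLowerRow hU, DeclRowsCorrLowerRow.of_squareCorrLowerRow⟩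

/-- Upper twin of `declRowsCorrLowerRow_iff`. [cite: WangEtAl2024, §III] [cite: LiebPRL1989, Theorem 2] -/
theorem declRowsCorrUpperRow_iff {U : ℝ} (hU : 0 < U) {u q : ℚ} {Λ : Finset (Site 2)} {X : FermionOp Λ} :
    DeclRowsCorrUpperRow U u q Λ X ↔ SquareCorrUpperRow U u q Λ X :=
  ⟨fun h => h.squareCorrUpperRow hU, DeclRowsCorrUpperRow.of_squareCorrUpperRow⟩

/-! ## §3 Joins to the M2 row vocabulary -/

/-- **Table cell from two declared-row nodes + a certified energy ceiling**: `lo ≤ Re ω_Λ(X) ≤ hi` on ALL of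
TLGS(U). [cite: WangEtAl2024, §III] [cite: BratteliRobinsonII1997, §6.2.4] -/
theorem CorrelatorRow.of_declRows {U : ℝ} (hU : 0 < U) {u lo hi : ℚ} {Λ : Finset (Site 2)} {X : FermionOp Λ}
    (hE : energyDensity2D 1 U 1 ≤ ((u : ℚ) : ℝ)) (hl : DeclRowsCorrLowerRow U u lo Λ X)
    (hu : DeclRowsCorrUpperRow U u hi Λ X) : CorrelatorRow U Λ X lo hi :=
  CorrelatorRow.of_lower_upper hE (hl.squareCorrLowerRow hU) (hu.squareCorrUpperRow hU)

/-- **C_nn LOWER cell row from a declared-row `Slo` node** (objective = bond average `spinDotNNAvg2`):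
`M2.SpinNNLowerRow U u q`. [cite: WangEtAl2024, §III] [cite: ShenQiuTian1994, Theorem and eqs. (7)–(9)] -/
theorem SpinNNLowerRow.of_declRows {U : ℝ} (hU : 0 < U) {u q : ℚ}
    (h : DeclRowsCorrLowerRow U u q nnSupport spinDotNNAvg2) : SpinNNLowerRow U u q :=
  SpinNNLowerRow.of_literal hU (h.squareCorrLowerRow hU)

/-- **C_nn UPPER cell row from a declared-row `Sup` node** (objective `ω(−V)`, `V` the bond average; the
m2-3 `cnn-srp` bundles): `M2.SpinNNUpperRow U u (−q)`. [cite: WangEtAl2024, §III] [cite: ShenQiuTian1994, Theorem and eqs. (7)–(9)] -/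
theorem SpinNNUpperRow.of_declRowsNeg {U : ℝ} (hU : 0 < U) {u q : ℚ}
    (h : DeclRowsCorrLowerRow U u q nnSupport spinDotNNAvg2Neg) : SpinNNUpperRow U u (-q) :=
  SpinNNUpperRow.of_literalNeg hU (h.squareCorrLowerRow hU)

/-- **docc LOWER row from a declared-row node** at the origin word. [cite: WangEtAl2024, §III] [cite: KomaTasaki1994, §1] -/
theorem _root_.Summit.Ventures.CertifiedManyBodySolver.M2DoccLowerRow.of_declRows {U : ℝ} (hU : 0 < U)
    {u q : ℚ} (h : DeclRowsCorrLowerRow U u q ({0} : Finset (Site 2)) (doccAt0 2)) : M2DoccLowerRow U u q :=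
  h.squareCorrLowerRow hU

/-- **docc UPPER row from a declared-row node**. [cite: WangEtAl2024, §III] [cite: KomaTasaki1994, §1] -/
theorem _root_.Summit.Ventures.CertifiedManyBodySolver.M2DoccUpperRow.of_declRows {U : ℝ} (hU : 0 < U)
    {u q : ℚ} (h : DeclRowsCorrUpperRow U u q ({0} : Finset (Site 2)) (doccAt0 2)) : M2DoccUpperRow U u q :=
  h.squareCorrUpperRow hU

/-- **Sanity of the shape (no vacuity)**: TLGS(U) is nonempty and each of its states satisfies both declared
families, so a declared-row node with `q` above the true value is FALSE, not vacuously true.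
[cite: BratteliRobinsonII1997, §6.2.4] [cite: LiebPRL1989, Theorem 2] -/
theorem exists_isTLGS_liebRows_wardRows {U : ℝ} (hU : 0 < U) :
    ∃ ω : InfVolFermionState 2, IsTLGS U ω ∧ LiebRows ω ∧ WardRows ω := by
  obtain ⟨ω, hω⟩ := IsTLGS.nonempty hU
  exact ⟨ω, hω, hω.liebRows hU, hω.wardRows hU⟩

end M2

end Summit.Ventures.CertifiedManyBodySolver
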